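import Literature.Analysis.FluidPDE.ESSLocalHolderBlowupProperties
import Literature.Analysis.FluidPDE.ESSLocalHolderApexTrace
import HarnessLib

/-!
# ESS Thm. 1.4 (`ess_local_holder`): the blow-up limit vanishes at the final time
# (Seregin 2014, §6.6, (6.6.3) `u(·,0) = 0`; ESS 2003, §3 (3.13))

Analysis/FluidPDE proofs-only file (theorems only: no definitions, no named facts) in the
bottom-up discharge of `Literature.Analysis.FluidPDE.ess_local_holder` (L. Escauriaza,
G. Seregin, V. Šverák, Russ. Math. Surveys 58:2 (2003) 211–250, Thm. 1.4). For the blow-up limit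
`w` of the rescaled velocities `u^{μ_j}(s, y) = μ_j v(t₀ + μ_j² s, x₀ + μ_j y)` around a point
`z₀ = (t₀, x₀) ∈ Q̄(1/2)` (`exists_blowup_limit`) this file proves the weak form of
G. Seregin, *Lecture Notes on Regularity Theory for the Navier–Stokes Equations* (2014), (6.6.3)
"`u(·, 0) = 0`": for every test field `φ`, `∫ ⟪w(s), φ⟫ → 0` as `s ↑ 0` (essentially). The
printed derivation ((6.6.2) ⇒ (6.6.3), p. 127) compares `u(·,0)` with `u^{(k)}(·,0)`, i.e. with
`λ_k v(λ_k ·, 0)`, which is small on `B(a)` because `v(·, 0)` — the value at the apex time — is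
an `L³` (indeed `L_{9/8}`) function; for the a.e.-defined field the value at the apex time is the
weak trace `v̂ ∈ L³` of `ESSLocalHolderApexTrace.lean`, and the comparison is made on the
pairings:

* `integral_inner_zoom_eq` — `∫ ⟪u^{μ}(s), φ⟫ = μ⁻² ∫_{B(x₀,1/2)} ⟪v(t₀ + μ² s), φ(μ⁻¹(· - x₀))⟫`
  (change of variables);
* `tendsto_apex_pairing_zero` — the apex values `ℓ_j = μ_j⁻² ∫ ⟪v̂, φ(μ_j⁻¹(· - x₀))⟫` tend to
  `0` (`|ℓ_j| ≲ ‖v̂‖_{L³(B(x₀, ρ μ_j))} → 0`, absolute continuity of `∫ |v̂|³`);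
* `exists_uniform_pairing_modulus_zoom` — the pairings `s ↦ ∫ ⟪u^{μ_j}(s), φ⟫` have a modulus
  of continuity on `]-ρ², 0[` **independent of `j`** (the tree's
  `NSCylinder.exists_fullMeasure_pairing_modulus`, fed with the scale-invariant sliced `L³` bound
  and the bound `D ≤ D⋆` of `ESSLocalHolderConcentration.lean`);
* `blowup_top_vanishing` — **(6.6.3) in weak form**: for every test field `φ` and `ε > 0` there
  is `s₀ < 0` with `|∫ ⟪w(s), φ⟫| ≤ ε` for a.e. `s ∈ ]s₀, 0[`.

Nothing accepted is restated or changed; no `sorry`.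

## References

* L. Escauriaza, G. Seregin, V. Šverák, Russ. Math. Surveys 58:2 (2003) 211–250: §3 (3.13).
  [`EscauriazaSereginSverak2003`]
* G. Seregin, *Lecture Notes on Regularity Theory for the Navier–Stokes Equations*, World
  Scientific (2014), §6.6, (6.6.2)–(6.6.3), p. 127. [`Seregin2014`]
-/

noncomputable section

open MeasureTheory Set Function Filter Topology TopologicalSpace Metric
open scoped NNReal ENNReal InnerProductSpace RealInnerProductSpace Laplacian

namespace Literature.Analysis.FluidPDE

section Top

variable {v : ℝ → EuclideanSpace ℝ (Fin 3) → EuclideanSpace ℝ (Fin 3)}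
  {p : ℝ → EuclideanSpace ℝ (Fin 3) → ℝ}

/-! ### Test fields transported to the shrinking balls `B(x₀, ρ μ)` -/

/-- The transported test field `θ(x) = φ(μ⁻¹(x - x₀))` is a test field on `B(x₀, 1/2)` when
`tsupport φ ⊆ B(0, ρ)` and `ρ μ ≤ 1/2` (`μ > 0`). [folklore] -/
theorem isTestFunctionOn_transport {φ : EuclideanSpace ℝ (Fin 3) → EuclideanSpace ℝ (Fin 3)}
    (hφ : ContDiff ℝ (⊤ : ℕ∞) φ) (hφc : HasCompactSupport φ) {ρ : ℝ}
    (hφρ : tsupport φ ⊆ ball (0 : EuclideanSpace ℝ (Fin 3)) ρ) {μ : ℝ} (hμ : 0 < μ)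
    (hρμ : ρ * μ ≤ 1 / 2) (x₀ : EuclideanSpace ℝ (Fin 3)) :
    FunctionSpaces.IsTestFunctionOn
      (⟨ball x₀ (1 / 2), isOpen_ball⟩ : Opens (EuclideanSpace ℝ (Fin 3)))
      (fun x => φ (μ⁻¹ • (x - x₀))) := by
  set A : EuclideanSpace ℝ (Fin 3) ≃ₜ EuclideanSpace ℝ (Fin 3) :=
    (Homeomorph.addRight (-x₀)).trans (Homeomorph.smulOfNeZero μ⁻¹ (inv_ne_zero hμ.ne')) with hA
  have hAe : (fun x => φ (μ⁻¹ • (x - x₀))) = φ ∘ A := by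
    funext x
    simp [hA, Homeomorph.trans_apply, sub_eq_add_neg]
  refine ⟨?_, ?_, ?_⟩
  · exact hφ.comp ((contDiff_const_smul μ⁻¹).comp (contDiff_id.sub contDiff_const))
  · rw [hAe]; exact hφc.comp_homeomorph A
  · -- `tsupport (φ ∘ A) ⊆ A⁻¹(tsupport φ) ⊆ B(x₀, ρμ) ⊆ B(x₀, 1/2)`
    intro x hx
    have hcont : Continuous fun x : EuclideanSpace ℝ (Fin 3) => μ⁻¹ • (x - x₀) := by fun_prop
    have h1 : x ∈ (fun x => μ⁻¹ • (x - x₀)) ⁻¹' tsupport φ := by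
      have hsub : support (fun x => φ (μ⁻¹ • (x - x₀))) ⊆ (fun x => μ⁻¹ • (x - x₀)) ⁻¹' tsupport φ :=
        fun y hy => subset_tsupport _ (by simpa using hy)
      exact (closure_minimal hsub ((isClosed_tsupport φ).preimage hcont)) hx
    have h2 : ‖μ⁻¹ • (x - x₀)‖ < ρ := by
      have := hφρ h1
      rwa [mem_ball, dist_zero_right] at this
    show x ∈ ball x₀ (1 / 2)
    rw [mem_ball, dist_eq_norm]
    rw [norm_smul, Real.norm_eq_abs, abs_of_pos (inv_pos.2 hμ), inv_mul_lt_iff₀ hμ] at h2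
    calc ‖x - x₀‖ < μ * ρ := h2
      _ = ρ * μ := mul_comm _ _
      _ ≤ 1 / 2 := hρμ

/-- **The pairing of the rescaled velocity with a test field**, by the change of variables
`x = x₀ + μ y` (`μ > 0`): `∫ ⟪u^μ(s), φ⟫ = μ⁻² ∫ ⟪v(t₀ + μ² s), φ(μ⁻¹(· - x₀))⟫`. [folklore] -/
theorem integral_inner_zoom_eq (v : ℝ → EuclideanSpace ℝ (Fin 3) → EuclideanSpace ℝ (Fin 3))
    (φ : EuclideanSpace ℝ (Fin 3) → EuclideanSpace ℝ (Fin 3)) {μ : ℝ} (hμ : 0 < μ)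
    (z₀ : ℝ × EuclideanSpace ℝ (Fin 3)) (s : ℝ) :
    ∫ y, ⟪(μ • stPull (μ ^ 2) μ z₀.1 z₀.2 v) s y, φ y⟫ =
      (μ ^ 2)⁻¹ * ∫ x, ⟪v (z₀.1 + μ ^ 2 * s) x, φ (μ⁻¹ • (x - z₀.2))⟫ := by
  have h1 := integral_comp_space_affine hμ z₀.2
    (fun x => ⟪v (z₀.1 + μ ^ 2 * s) x, φ (μ⁻¹ • (x - z₀.2))⟫)
  rw [finrank_euclideanSpace_fin] at h1
  have e : ∀ y : EuclideanSpace ℝ (Fin 3),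
      ⟪(μ • stPull (μ ^ 2) μ z₀.1 z₀.2 v) s y, φ y⟫ =
        μ * (fun x => ⟪v (z₀.1 + μ ^ 2 * s) x, φ (μ⁻¹ • (x - z₀.2))⟫) (z₀.2 + μ • y) := by
    intro y
    rw [smul_stPull_apply, real_inner_smul_left]
    simp only [add_sub_cancel_left, smul_smul, inv_mul_cancel₀ hμ.ne', one_smul]
  simp_rw [e]
  rw [integral_const_mul, h1, smul_eq_mul, ← mul_assoc]
  congr 1
  field_simp

/-- The pairing over the whole space equals the pairing over `B(x₀, 1/2)` for a test field
supported there. [folklore] -/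
theorem integral_inner_eq_setIntegral_of_tsupport {f θ : EuclideanSpace ℝ (Fin 3) → EuclideanSpace ℝ (Fin 3)}
    {S : Set (EuclideanSpace ℝ (Fin 3))} (hθ : tsupport θ ⊆ S) :
    ∫ x, ⟪f x, θ x⟫ = ∫ x in S, ⟪f x, θ x⟫ := by
  refine (setIntegral_eq_integral_of_forall_compl_eq_zero fun x hx => ?_).symm
  have : θ x = 0 := image_eq_zero_of_notMem_tsupport fun h => hx (hθ h)
  rw [this, inner_zero_right]

/-! ### The apex values of the rescaled pairings tend to zero -/

/-- **The apex values tend to zero** (Seregin 2014, (6.6.2) ⇒ (6.6.3)): for `v̂ ∈ L³(ℝ³)`, a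
bounded test field `φ` with `tsupport φ ⊆ B(0, ρ)` and scales `μ_j → 0⁺`,
`μ_j⁻² ∫ ⟪v̂, φ(μ_j⁻¹(· - x₀))⟫ → 0`: the integrand lives on `B(x₀, ρ μ_j)`, where
`μ⁻² ∫_{B(x₀,ρμ)} |v̂| |φ| ≤ K₀ μ⁻² ‖v̂‖_{L³(B(x₀,ρμ))} |B(x₀,ρμ)|^{2/3} = K₀ c ρ² ‖v̂‖_{L³(B(x₀,ρμ))}`
and `∫_{B(x₀, r)} |v̂|³ → 0` as `r → 0`. [cite: Seregin2014, §6.6 (6.6.2)–(6.6.3)] -/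
theorem tendsto_apex_pairing_zero {vh : EuclideanSpace ℝ (Fin 3) → EuclideanSpace ℝ (Fin 3)}
    (hvh : MemLp vh 3 volume) {φ : EuclideanSpace ℝ (Fin 3) → EuclideanSpace ℝ (Fin 3)}
    {K₀ ρ : ℝ} (hK₀ : ∀ x, ‖φ x‖ ≤ K₀)
    (hφρ : tsupport φ ⊆ ball (0 : EuclideanSpace ℝ (Fin 3)) ρ) (hρ : 0 < ρ)
    (x₀ : EuclideanSpace ℝ (Fin 3)) {μ : ℕ → ℝ} (hμ : ∀ j, 0 < μ j)
    (hμ0 : Tendsto μ atTop (𝓝 0)) :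
    Tendsto (fun j => (μ j ^ 2)⁻¹ * ∫ x, ⟪vh x, φ ((μ j)⁻¹ • (x - x₀))⟫) atTop (𝓝 0) := by
  have hK₀0 : 0 ≤ K₀ := (norm_nonneg _).trans (hK₀ 0)
  -- the balls `B(x₀, ρ μ_j)` shrink
  set B : ℕ → Set (EuclideanSpace ℝ (Fin 3)) := fun j => ball x₀ (ρ * μ j) with hB
  have hvolB : ∀ j, volume (B j) = ENNReal.ofReal ((ρ * μ j) ^ 3) *
      volume (ball (0 : EuclideanSpace ℝ (Fin 3)) 1) := by
    intro j
    rw [hB, Measure.addHaar_ball_of_pos _ _ (by have := hμ j; positivity), finrank_euclideanSpace_fin]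
  have hvol1 : volume (ball (0 : EuclideanSpace ℝ (Fin 3)) 1) ≠ ∞ := measure_ball_lt_top.ne
  have hvolB_tendsto : Tendsto (fun j => volume (B j)) atTop (𝓝 0) := by
    simp_rw [hvolB]
    have h1 : Tendsto (fun j => (ρ * μ j) ^ 3) atTop (𝓝 ((ρ * 0) ^ 3)) :=
      (hμ0.const_mul ρ).pow 3
    rw [mul_zero, zero_pow three_ne_zero] at h1
    have h2 : Tendsto (fun j => ENNReal.ofReal ((ρ * μ j) ^ 3)) atTop (𝓝 0) := by
      have := ENNReal.tendsto_ofReal h1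
      rwa [ENNReal.ofReal_zero] at this
    have := ENNReal.Tendsto.mul_const h2 (Or.inr hvol1)
    rwa [zero_mul] at this
  -- `∫_{B_j} |v̂|³ → 0`
  have hint3 : ∫⁻ x, ‖vh x‖ₑ ^ (3 : ℝ) ≠ ∞ := by
    have h := hvh.eLpNorm_lt_top
    rw [eLpNorm_eq_lintegral_rpow_enorm_toReal (by norm_num) (by norm_num), ENNReal.toReal_ofNat] at h
    exact ((ENNReal.rpow_lt_top_iff_of_pos (by norm_num)).1 h).ne
  have hI3 : Tendsto (fun j => ∫⁻ x in B j, ‖vh x‖ₑ ^ (3 : ℝ)) atTop (𝓝 0) :=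
    tendsto_setLIntegral_zero hint3 hvolB_tendsto
  -- `‖v̂‖_{L³(B_j)} → 0`
  have hN3 : Tendsto (fun j => eLpNorm vh 3 (volume.restrict (B j))) atTop (𝓝 0) := by
    have e : ∀ j, eLpNorm vh 3 (volume.restrict (B j)) = (∫⁻ x in B j, ‖vh x‖ₑ ^ (3 : ℝ)) ^ (1 / 3 : ℝ) := by
      intro j
      rw [eLpNorm_eq_lintegral_rpow_enorm_toReal (by norm_num) (by norm_num), ENNReal.toReal_ofNat]
    simp_rw [e]
    have := ((ENNReal.continuous_rpow_const (y := 1 / (3 : ℝ))).tendsto 0).comp hI3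
    rwa [ENNReal.zero_rpow_of_pos (by norm_num)] at this
  -- ## the bound `|ℓ_j| ≤ K₀ c ρ² ‖v̂‖_{L³(B_j)}`
  set c₀ : ℝ≥0∞ := volume (ball (0 : EuclideanSpace ℝ (Fin 3)) 1) ^ (2 / 3 : ℝ) with hc₀
  have hc₀top : c₀ ≠ ∞ := ENNReal.rpow_ne_top_of_nonneg (by norm_num) hvol1
  have hbound : ∀ j, ‖(μ j ^ 2)⁻¹ * ∫ x, ⟪vh x, φ ((μ j)⁻¹ • (x - x₀))⟫‖ₑ ≤
      ENNReal.ofReal (K₀ * ρ ^ 2) * c₀ * eLpNorm vh 3 (volume.restrict (B j)) := by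
    intro j
    have hμj := hμ j
    -- the integrand is supported in `B_j`
    have hsupp : ∀ x, x ∉ B j → φ ((μ j)⁻¹ • (x - x₀)) = 0 := by
      intro x hx
      refine image_eq_zero_of_notMem_tsupport fun h => hx ?_
      have h2 := hφρ h
      rw [mem_ball, dist_zero_right, norm_smul, Real.norm_eq_abs, abs_of_pos (inv_pos.2 hμj),
        inv_mul_lt_iff₀ hμj] at h2
      rw [hB, mem_ball, dist_eq_norm]
      linarith [mul_comm ρ (μ j)]
    have hset : ∫ x, ⟪vh x, φ ((μ j)⁻¹ • (x - x₀))⟫ = ∫ x in B j, ⟪vh x, φ ((μ j)⁻¹ • (x - x₀))⟫ := by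
      refine (setIntegral_eq_integral_of_forall_compl_eq_zero fun x hx => ?_).symm
      rw [hsupp x hx, inner_zero_right]
    -- `L¹` bound on `B_j`, then Hölder `L¹ ≤ L³ |B_j|^{2/3}`
    have hvm : AEStronglyMeasurable vh (volume.restrict (B j)) := hvh.1.restrict
    have h1 : ‖∫ x in B j, ⟪vh x, φ ((μ j)⁻¹ • (x - x₀))⟫‖ₑ ≤
        ENNReal.ofReal K₀ * eLpNorm vh 1 (volume.restrict (B j)) := by
      refine (enorm_integral_le_lintegral_enorm _).trans ?_
      rw [eLpNorm_one_eq_lintegral_enorm, ← lintegral_const_mul' _ _ ENNReal.ofReal_ne_top]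
      refine lintegral_mono fun x => ?_
      rw [← ofReal_norm, ← ofReal_norm, ← ENNReal.ofReal_mul hK₀0]
      refine ENNReal.ofReal_le_ofReal ?_
      calc ‖⟪vh x, φ ((μ j)⁻¹ • (x - x₀))⟫‖ ≤ ‖vh x‖ * ‖φ ((μ j)⁻¹ • (x - x₀))‖ := norm_inner_le_norm _ _
        _ ≤ ‖vh x‖ * K₀ := mul_le_mul_of_nonneg_left (hK₀ _) (norm_nonneg _)
        _ = K₀ * ‖vh x‖ := mul_comm _ _
    have h2 : eLpNorm vh 1 (volume.restrict (B j)) ≤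
        eLpNorm vh 3 (volume.restrict (B j)) * (ENNReal.ofReal ((ρ * μ j) ^ 3) *
          volume (ball (0 : EuclideanSpace ℝ (Fin 3)) 1)) ^ (2 / 3 : ℝ) := by
      have := eLpNorm_le_eLpNorm_mul_rpow_measure_univ (p := 1) (q := 3) (by norm_num) hvm
      rw [Measure.restrict_apply_univ, hvolB, ENNReal.toReal_one, ENNReal.toReal_ofNat,
        show (1 / 1 - 1 / 3 : ℝ) = 2 / 3 by norm_num] at this
      exact this
    have h3 : (ENNReal.ofReal ((ρ * μ j) ^ 3) * volume (ball (0 : EuclideanSpace ℝ (Fin 3)) 1)) ^ (2 / 3 : ℝ) =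
        ENNReal.ofReal ((ρ * μ j) ^ 2) * c₀ := by
      rw [ENNReal.mul_rpow_of_nonneg _ _ (by norm_num), hc₀, ENNReal.ofReal_rpow_of_nonneg (by positivity)
        (by norm_num), ← Real.rpow_natCast, ← Real.rpow_mul (by positivity)]
      norm_num
    rw [enorm_mul, hset]
    have e4 : ‖(μ j ^ 2)⁻¹‖ₑ = ENNReal.ofReal ((μ j ^ 2)⁻¹) := Real.enorm_eq_ofReal (by positivity)
    rw [e4]
    calc ENNReal.ofReal ((μ j ^ 2)⁻¹) * ‖∫ x in B j, ⟪vh x, φ ((μ j)⁻¹ • (x - x₀))⟫‖ₑ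
        ≤ ENNReal.ofReal ((μ j ^ 2)⁻¹) * (ENNReal.ofReal K₀ * (eLpNorm vh 3 (volume.restrict (B j)) *
            (ENNReal.ofReal ((ρ * μ j) ^ 2) * c₀))) := by
          refine mul_le_mul' le_rfl (h1.trans (mul_le_mul' le_rfl ?_))
          rw [← h3]; exact h2
      _ = ENNReal.ofReal (K₀ * ρ ^ 2) * c₀ * eLpNorm vh 3 (volume.restrict (B j)) := by
          have e5 : ENNReal.ofReal ((μ j ^ 2)⁻¹) * ENNReal.ofReal K₀ * ENNReal.ofReal ((ρ * μ j) ^ 2) =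
              ENNReal.ofReal (K₀ * ρ ^ 2) := by
            rw [← ENNReal.ofReal_mul (by positivity), ← ENNReal.ofReal_mul (by positivity)]
            congr 1
            field_simp
          calc ENNReal.ofReal ((μ j ^ 2)⁻¹) * (ENNReal.ofReal K₀ * (eLpNorm vh 3 (volume.restrict (B j)) *
                (ENNReal.ofReal ((ρ * μ j) ^ 2) * c₀)))
              = (ENNReal.ofReal ((μ j ^ 2)⁻¹) * ENNReal.ofReal K₀ * ENNReal.ofReal ((ρ * μ j) ^ 2)) * c₀ *
                  eLpNorm vh 3 (volume.restrict (B j)) := by ring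
            _ = ENNReal.ofReal (K₀ * ρ ^ 2) * c₀ * eLpNorm vh 3 (volume.restrict (B j)) := by rw [e5]
  -- ## conclusion
  have hlim : Tendsto (fun j => ENNReal.ofReal (K₀ * ρ ^ 2) * c₀ * eLpNorm vh 3 (volume.restrict (B j)))
      atTop (𝓝 0) := by
    have := ENNReal.Tendsto.const_mul (a := ENNReal.ofReal (K₀ * ρ ^ 2) * c₀) hN3
      (Or.inr (ENNReal.mul_ne_top ENNReal.ofReal_ne_top hc₀top))
    rwa [mul_zero] at this
  have h0 : Tendsto (fun j => ‖(μ j ^ 2)⁻¹ * ∫ x, ⟪vh x, φ ((μ j)⁻¹ • (x - x₀))⟫‖ₑ) atTop (𝓝 0) :=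
    tendsto_of_tendsto_of_tendsto_of_le_of_le tendsto_const_nhds hlim (fun j => bot_le) hbound
  have h0' : Tendsto (fun j => ‖(μ j ^ 2)⁻¹ * ∫ x, ⟪vh x, φ ((μ j)⁻¹ • (x - x₀))⟫‖) atTop (𝓝 0) := by
    have h1 := (ENNReal.tendsto_toReal ENNReal.zero_ne_top).comp h0
    rw [ENNReal.toReal_zero] at h1
    refine (tendsto_congr fun j => ?_).1 h1
    exact toReal_enorm _
  exact tendsto_zero_iff_norm_tendsto_zero.2 h0'

/-! ### A modulus of continuity of the rescaled pairings, uniform in the scale -/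

/-- The rescaled pair at scale `μ` is a suitable weak solution in `Q(ρ)` whenever `ρ μ ≤ 1/2`
(`0 < μ`, `0 < ρ`): zoom in by `ρ` the rescaled pair at the scale `ρ μ`, which is suitable in the
unit ball (`zoom_isSuitableWeakSolutionInBall`), and zoom back out
(`IsSuitableWeakSolutionInBall.zoomOut`). [cite: EscauriazaSereginSverak2003, §3 (3.8)–(3.9)] -/
theorem zoom_isSuitableWeakSolutionInBall_radius
    (h : IsL3inftyLocalPair 1 1 ((0 : ℝ), (0 : EuclideanSpace ℝ (Fin 3))) v p)
    {z₀ : ℝ × EuclideanSpace ℝ (Fin 3)}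
    (hz₀ : z₀ ∈ closure (parabolicCylinder (1 / 2) ((0 : ℝ), (0 : EuclideanSpace ℝ (Fin 3)))))
    {μ ρ : ℝ} (hμ : 0 < μ) (hρ : 0 < ρ) (hρμ : ρ * μ ≤ 1 / 2) :
    IsSuitableWeakSolutionInBall ρ (0 : ℝ × EuclideanSpace ℝ (Fin 3))
      (μ • stPull (μ ^ 2) μ z₀.1 z₀.2 v) (μ ^ 2 • stPull (μ ^ 2) μ z₀.1 z₀.2 p) := by
  have h1 := zoom_isSuitableWeakSolutionInBall h hz₀ (R := ρ * μ) ⟨by positivity, hρμ⟩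
  have eU : (ρ * μ) • stPull ((ρ * μ) ^ 2) (ρ * μ) z₀.1 z₀.2 v =
      ρ • stPull (ρ ^ 2) ρ (0 : ℝ) (0 : EuclideanSpace ℝ (Fin 3)) (μ • stPull (μ ^ 2) μ z₀.1 z₀.2 v) :=
    (zoom_zoom ρ μ ρ μ z₀.1 z₀.2 v).symm
  have eP : (ρ * μ) ^ 2 • stPull ((ρ * μ) ^ 2) (ρ * μ) z₀.1 z₀.2 p =
      ρ ^ 2 • stPull (ρ ^ 2) ρ (0 : ℝ) (0 : EuclideanSpace ℝ (Fin 3)) (μ ^ 2 • stPull (μ ^ 2) μ z₀.1 z₀.2 p) := by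
    rw [zoom_zoom, mul_pow]
  rw [eU, eP] at h1
  have h2 := h1.zoomOut (inv_pos.2 hρ)
  have e1 : (1 : ℝ) / ρ⁻¹ = ρ := by rw [one_div, inv_inv]
  rw [e1] at h2
  have e2 : ρ⁻¹ • stPull (ρ⁻¹ ^ 2) ρ⁻¹ (0 : ℝ) (0 : EuclideanSpace ℝ (Fin 3))
      (ρ • stPull (ρ ^ 2) ρ (0 : ℝ) (0 : EuclideanSpace ℝ (Fin 3)) (μ • stPull (μ ^ 2) μ z₀.1 z₀.2 v)) =
      μ • stPull (μ ^ 2) μ z₀.1 z₀.2 v := by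
    have := zoom_zoom_origin_inv (c := ρ⁻¹) (inv_ne_zero hρ.ne') ρ⁻¹ ρ (inv_mul_cancel₀ hρ.ne')
      (μ • stPull (μ ^ 2) μ z₀.1 z₀.2 v)
    rwa [inv_inv] at this
  have e3 : ρ⁻¹ ^ 2 • stPull (ρ⁻¹ ^ 2) ρ⁻¹ (0 : ℝ) (0 : EuclideanSpace ℝ (Fin 3))
      (ρ ^ 2 • stPull (ρ ^ 2) ρ (0 : ℝ) (0 : EuclideanSpace ℝ (Fin 3)) (μ ^ 2 • stPull (μ ^ 2) μ z₀.1 z₀.2 p)) =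
      μ ^ 2 • stPull (μ ^ 2) μ z₀.1 z₀.2 p := by
    have := zoom_zoom_origin_inv (c := ρ⁻¹) (inv_ne_zero hρ.ne') (ρ⁻¹ ^ 2) (ρ ^ 2)
      (by rw [← mul_pow, inv_mul_cancel₀ hρ.ne', one_pow]) (μ ^ 2 • stPull (μ ^ 2) μ z₀.1 z₀.2 p)
    rwa [inv_inv] at this
  rw [e2, e3] at h2
  exact h2

/-- **A modulus of continuity of the pairings of the rescaled velocities, uniform in the scale**
(Temam 1977/79, Ch. III §3 (3.40)–(3.43); the tree's `NSCylinder.exists_fullMeasure_pairing_modulus`):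
for a test field `φ` with `tsupport φ ⊆ B(0, ρ)`, `ρ ≥ 1`, there are `A, B ≥ 0` such that for
every scale `0 < μ` with `ρ μ ≤ 1/2` the pairing `s ↦ ∫ ⟪u^μ(s), φ⟫` satisfies
`|∫ ⟪u^μ(s), φ⟫ - ∫ ⟪u^μ(s'), φ⟫| ≤ A |s - s'| + B |s - s'|^{1/3}` for all `s, s'` in a full-measure
subset of `]-ρ², 0[`. The constants of the modulus see the solution only through the sliced `L²`
bound on `B(0, ρ)` (which is uniform in `μ`: Hölder from the scale-invariant sliced `L³` bound,
`exists_ae_lintegral_ball_cube_zoom_le`) and the `L^{3/2}(Q(ρ))` bound of the pressure (uniform: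
`ρ² D(ρμ; z₀) ≤ ρ² D⋆`, `exists_cknD_le`). [cite: EscauriazaSereginSverak2003, §3 (3.13)] [cite: Seregin2014, §6.6 Prop. 6.20] -/
theorem exists_uniform_pairing_modulus_zoom
    (h : IsL3inftyLocalPair 1 1 ((0 : ℝ), (0 : EuclideanSpace ℝ (Fin 3))) v p)
    {z₀ : ℝ × EuclideanSpace ℝ (Fin 3)}
    (hz₀ : z₀ ∈ closure (parabolicCylinder (1 / 2) ((0 : ℝ), (0 : EuclideanSpace ℝ (Fin 3)))))
    {φ : EuclideanSpace ℝ (Fin 3) → EuclideanSpace ℝ (Fin 3)} (hφ : ContDiff ℝ (⊤ : ℕ∞) φ)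
    (hφc : HasCompactSupport φ) {ρ : ℝ} (hρ1 : 1 ≤ ρ)
    (hφρ : tsupport φ ⊆ ball (0 : EuclideanSpace ℝ (Fin 3)) ρ) :
    ∃ A B : ℝ, 0 ≤ A ∧ 0 ≤ B ∧ ∀ μ : ℝ, 0 < μ → ρ * μ ≤ 1 / 2 →
      ∃ S : Set ℝ, (∀ᵐ s ∂(volume.restrict (Ioo (-ρ ^ 2) 0)), s ∈ S) ∧ ∀ s ∈ S, ∀ s' ∈ S,
        |(∫ y, ⟪(μ • stPull (μ ^ 2) μ z₀.1 z₀.2 v) s y, φ y⟫) -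
            ∫ y, ⟪(μ • stPull (μ ^ 2) μ z₀.1 z₀.2 v) s' y, φ y⟫| ≤
          A * |s - s'| + B * |s - s'| ^ (1 / 3 : ℝ) := by
  have hρ : 0 < ρ := one_pos.trans_le hρ1
  obtain ⟨M, hM⟩ := exists_ae_lintegral_ball_cube_zoom_le h
  obtain ⟨D, hD⟩ := exists_cknD_le h hz₀
  set Ω : Opens (EuclideanSpace ℝ (Fin 3)) := ⟨ball 0 ρ, isOpen_ball⟩ with hΩdef
  have hΩset : ((Ω : Opens (EuclideanSpace ℝ (Fin 3))) : Set (EuclideanSpace ℝ (Fin 3))) = ball 0 ρ := rfl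
  have hbΩ : Bornology.IsBounded ((Ω : Opens (EuclideanSpace ℝ (Fin 3))) :
      Set (EuclideanSpace ℝ (Fin 3))) := by rw [hΩset]; exact isBounded_ball
  have hηt : FunctionSpaces.IsTestFunctionOn Ω φ := ⟨hφ, hφc, hφρ⟩
  obtain ⟨K₀, K₁, K₂, hK₀, hK₁, hK₂⟩ := exists_bounds_of_isTestFunctionOn hηt
  -- ## the uniform constants
  set C : ℝ≥0∞ := (M : ℝ≥0∞) ^ (2 / 3 : ℝ) * volume (ball (0 : EuclideanSpace ℝ (Fin 3)) ρ) ^ (1 / 3 : ℝ)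
    with hC
  have hvolB : volume (ball (0 : EuclideanSpace ℝ (Fin 3)) ρ) ≠ ∞ := measure_ball_lt_top.ne
  have hCtop : C ≠ ∞ := ENNReal.mul_ne_top (ENNReal.rpow_ne_top_of_nonneg (by norm_num) ENNReal.coe_ne_top)
    (ENNReal.rpow_ne_top_of_nonneg (by norm_num) hvolB)
  set Cp : ℝ≥0∞ := ENNReal.ofReal ρ ^ 2 * D with hCp
  have hCptop : Cp ≠ ∞ := ENNReal.mul_ne_top (ENNReal.pow_ne_top ENNReal.ofReal_ne_top) ENNReal.coe_ne_top
  set A : ℝ := K₁ * C.toReal + K₂ * ((volume ((Ω : Opens (EuclideanSpace ℝ (Fin 3))) :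
      Set (EuclideanSpace ℝ (Fin 3)))).toReal + C.toReal) with hA
  set B : ℝ := 3 * K₁ * (((volume ((Ω : Opens (EuclideanSpace ℝ (Fin 3))) :
      Set (EuclideanSpace ℝ (Fin 3)))) ^ (1 / 2 : ℝ) * Cp) ^ (2 / 3 : ℝ)).toReal with hB
  have hK₁0 : 0 ≤ K₁ := (norm_nonneg _).trans (hK₁ 0)
  have hK₂0 : 0 ≤ K₂ := (norm_nonneg _).trans (hK₂ 0)
  refine ⟨A, B, by positivity, by positivity, fun μ hμ hρμ => ?_⟩
  -- ## the rescaled pair on `]-ρ², 0[ × B(0, ρ)`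
  set a : ℝ := (0 : ℝ × EuclideanSpace ℝ (Fin 3)).1 - ρ ^ 2 with ha
  set b : ℝ := (0 : ℝ × EuclideanSpace ℝ (Fin 3)).1 with hb
  have hab' : Ioo a b = Ioo (-ρ ^ 2) 0 := by
    rw [ha, hb]; show Ioo ((0 : ℝ) - ρ ^ 2) 0 = Ioo (-ρ ^ 2) 0; rw [zero_sub]
  have hcyl : timeCylinder Ω a b = parabolicCylinderOpens ρ (0 : ℝ × EuclideanSpace ℝ (Fin 3)) := rfl
  have hcyl_set : Ioo a b ×ˢ ((Ω : Opens (EuclideanSpace ℝ (Fin 3))) : Set (EuclideanSpace ℝ (Fin 3))) =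
      parabolicCylinder ρ (0 : ℝ × EuclideanSpace ℝ (Fin 3)) := rfl
  have hball := zoom_isSuitableWeakSolutionInBall_radius h hz₀ hμ hρ hρμ
  have hsol : IsDistributionalNSSolutionOn (timeCylinder Ω a b) 1 0
      (μ • stPull (μ ^ 2) μ z₀.1 z₀.2 v) (μ ^ 2 • stPull (μ ^ 2) μ z₀.1 z₀.2 p) := by
    rw [hcyl]; exact hball.1.distributional
  -- the sliced `L²` bound, uniformly in `μ`
  have hμhalf : μ ≤ 1 / 2 := le_trans (by nlinarith) hρμ
  have hmeasU : AEStronglyMeasurable (uncurry (μ • stPull (μ ^ 2) μ z₀.1 z₀.2 v))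
      (volume.restrict (parabolicCylinder ρ (0 : ℝ × EuclideanSpace ℝ (Fin 3)))) :=
    aestronglyMeasurable_uncurry_zoom h hz₀ hμ hρ hρμ
  have hE : ∀ᵐ t ∂(volume.restrict (Ioo a b)),
      ∫⁻ x in ((Ω : Opens (EuclideanSpace ℝ (Fin 3))) : Set (EuclideanSpace ℝ (Fin 3))),
        ‖(μ • stPull (μ ^ 2) μ z₀.1 z₀.2 v) t x‖ₑ ^ 2 ≤ C := by
    rw [hab', hΩset]
    -- the sliced `L³` bound on the larger cylinder
    have h3 := hM z₀ hz₀ μ ⟨hμ, hμhalf⟩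
    have hIsub : Ioo (-ρ ^ 2) 0 ⊆ Ioo (-(3 / 4) / μ ^ 2) 0 := by
      refine Ioo_subset_Ioo ?_ le_rfl
      rw [neg_div, neg_le_neg_iff, le_div_iff₀ (by positivity)]
      nlinarith [mul_pos hρ hμ]
    have hBsub : ball (0 : EuclideanSpace ℝ (Fin 3)) ρ ⊆ ball 0 (1 / (2 * μ)) := by
      refine ball_subset_ball ?_
      rw [le_div_iff₀ (by positivity)]; linarith
    -- measurability of the slices
    have hsl : ∀ᵐ t ∂(volume.restrict (Ioo (-ρ ^ 2) 0)),
        AEStronglyMeasurable ((μ • stPull (μ ^ 2) μ z₀.1 z₀.2 v) t)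
          (volume.restrict (ball (0 : EuclideanSpace ℝ (Fin 3)) ρ)) := by
      have h0 := hmeasU
      rw [show parabolicCylinder ρ (0 : ℝ × EuclideanSpace ℝ (Fin 3)) = Ioo (-ρ ^ 2) 0 ×ˢ ball 0 ρ by
        rw [← hcyl_set, hab']; rfl, FunctionSpaces.AubinLions.volume_restrict_prod] at h0
      filter_upwards [h0.prodMk_left] with t ht
      exact ht
    filter_upwards [ae_restrict_of_ae_restrict_of_subset hIsub h3, hsl] with t ht hmt
    have h4 : ∫⁻ x in ball (0 : EuclideanSpace ℝ (Fin 3)) ρ,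
        ‖(μ • stPull (μ ^ 2) μ z₀.1 z₀.2 v) t x‖ₑ ^ (3 : ℕ) ≤ M := (lintegral_mono_set hBsub).trans ht
    -- Hölder `L² ≤ L³ |B|^{1/6}`
    have hH := eLpNorm_le_eLpNorm_mul_rpow_measure_univ (p := 2) (q := 3) (by norm_num) hmt
    rw [Measure.restrict_apply_univ, ENNReal.toReal_ofNat, ENNReal.toReal_ofNat,
      show (1 / 2 - 1 / 3 : ℝ) = 1 / 6 by norm_num] at hH
    have e2 : ∫⁻ x in ball (0 : EuclideanSpace ℝ (Fin 3)) ρ, ‖(μ • stPull (μ ^ 2) μ z₀.1 z₀.2 v) t x‖ₑ ^ 2 =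
        eLpNorm ((μ • stPull (μ ^ 2) μ z₀.1 z₀.2 v) t) 2 (volume.restrict (ball 0 ρ)) ^ (2 : ℝ) := by
      rw [eLpNorm_eq_lintegral_rpow_enorm_toReal two_ne_zero ENNReal.ofNat_ne_top, ENNReal.toReal_ofNat,
        ← ENNReal.rpow_mul, show (1 / 2 : ℝ) * 2 = 1 by norm_num, ENNReal.rpow_one]
      exact lintegral_congr fun x => by rw [← ENNReal.rpow_natCast]; norm_num
    have e3 : eLpNorm ((μ • stPull (μ ^ 2) μ z₀.1 z₀.2 v) t) 3 (volume.restrict (ball 0 ρ)) ≤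
        (M : ℝ≥0∞) ^ (1 / 3 : ℝ) := by
      rw [eLpNorm_three_eq_lintegral_cube_rpow]
      exact ENNReal.rpow_le_rpow h4 (by norm_num)
    rw [e2]
    calc eLpNorm ((μ • stPull (μ ^ 2) μ z₀.1 z₀.2 v) t) 2 (volume.restrict (ball 0 ρ)) ^ (2 : ℝ)
        ≤ ((M : ℝ≥0∞) ^ (1 / 3 : ℝ) * volume (ball (0 : EuclideanSpace ℝ (Fin 3)) ρ) ^ (1 / 6 : ℝ)) ^ (2 : ℝ) :=
          ENNReal.rpow_le_rpow (hH.trans (mul_le_mul' e3 le_rfl)) (by norm_num)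
      _ = C := by
          rw [hC, ENNReal.mul_rpow_of_nonneg _ _ (by norm_num), ← ENNReal.rpow_mul, ← ENNReal.rpow_mul]
          norm_num
  -- the pressure bound, uniformly in `μ`
  have hP : ∫⁻ z in Ioo a b ×ˢ ((Ω : Opens (EuclideanSpace ℝ (Fin 3))) : Set (EuclideanSpace ℝ (Fin 3))),
      ‖(μ ^ 2 • stPull (μ ^ 2) μ z₀.1 z₀.2 p) z.1 z.2‖ₑ ^ (3 / 2 : ℝ) ≤ Cp := by
    rw [hcyl_set]
    have e : ∫⁻ z in parabolicCylinder ρ (0 : ℝ × EuclideanSpace ℝ (Fin 3)),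
        ‖(μ ^ 2 • stPull (μ ^ 2) μ z₀.1 z₀.2 p) z.1 z.2‖ₑ ^ (3 / 2 : ℝ) =
        ENNReal.ofReal ρ ^ 2 * cknD (ρ * μ) z₀ p := lintegral_pressure_zoom_radius hμ hρ z₀ p
    rw [e, hCp]
    exact mul_le_mul' le_rfl (hD _ ⟨by positivity, hρμ⟩)
  -- ## the modulus
  obtain ⟨S, hS, hmod⟩ := NSCylinder.exists_fullMeasure_pairing_modulus hsol hbΩ hCtop hCptop hE hP
    hηt hK₁ hK₂
  refine ⟨S, by rw [← hab']; exact hS, fun s hs s' hs' => ?_⟩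
  have h1 := hmod s hs s' hs'
  rw [hΩset, ← integral_inner_eq_setIntegral_of_tsupport hφρ,
    ← integral_inner_eq_setIntegral_of_tsupport hφρ] at h1
  exact h1

/-! ### The limit vanishes at the final time -/

/-- A modulus `A d + B d^{1/3}` is small for small `d`. [folklore] -/
theorem exists_modulus_le {A B ε : ℝ} (hA : 0 ≤ A) (hB : 0 ≤ B) (hε : 0 < ε) :
    ∃ d : ℝ, 0 < d ∧ ∀ x : ℝ, 0 ≤ x → x ≤ d → A * x + B * x ^ (1 / 3 : ℝ) ≤ ε := by
  set d : ℝ := min (ε / (2 * (A + 1))) ((ε / (2 * (B + 1))) ^ (3 : ℕ)) with hd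
  have hd0 : 0 < d := lt_min (by positivity) (by positivity)
  refine ⟨d, hd0, fun x hx hxd => ?_⟩
  have h1 : A * x ≤ ε / 2 := by
    have : x ≤ ε / (2 * (A + 1)) := hxd.trans (min_le_left _ _)
    calc A * x ≤ A * (ε / (2 * (A + 1))) := mul_le_mul_of_nonneg_left this hA
      _ ≤ ε / 2 := by
          rw [mul_div_assoc', div_le_div_iff₀ (by positivity) (by norm_num)]
          nlinarith
  have h2 : B * x ^ (1 / 3 : ℝ) ≤ ε / 2 := by
    have hx3 : x ^ (1 / 3 : ℝ) ≤ ε / (2 * (B + 1)) := by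
      have : x ≤ (ε / (2 * (B + 1))) ^ (3 : ℕ) := hxd.trans (min_le_right _ _)
      calc x ^ (1 / 3 : ℝ) ≤ ((ε / (2 * (B + 1))) ^ (3 : ℕ)) ^ (1 / 3 : ℝ) :=
            Real.rpow_le_rpow hx this (by norm_num)
        _ = ε / (2 * (B + 1)) := by
            rw [← Real.rpow_natCast, ← Real.rpow_mul (by positivity)]; norm_num
    calc B * x ^ (1 / 3 : ℝ) ≤ B * (ε / (2 * (B + 1))) := mul_le_mul_of_nonneg_left hx3 hB
      _ ≤ ε / 2 := by
          rw [mul_div_assoc', div_le_div_iff₀ (by positivity) (by norm_num)]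
          nlinarith
  linarith

/-- **The blow-up limit vanishes at the final time, weakly** (Seregin 2014, §6.6, (6.6.3)
"`u(·,0) = 0`"; ESS 2003, §3 (3.13)). Let `(v, p)` satisfy (1.15)–(1.16) on `Q(1)`,
`z₀ ∈ Q̄(1/2)`, and let `w` be a strong `L³(Q(a))` limit, for every `a > 0`, of the rescaled
velocities `u^{μ_j}`, `μ_j = 2^{-(δ(j)+2)}`, `δ(j) ≥ j` (as produced by `exists_blowup_limit`).
Then for every test field `φ` and `ε > 0` there is `s₀ < 0` with `|∫ ⟪w(s), φ⟫| ≤ ε` for a.e.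
`s ∈ ]s₀, 0[`. Proof: the pairings `s ↦ ∫ ⟪u^{μ_j}(s), φ⟫` share a modulus of continuity `ω`
(`exists_uniform_pairing_modulus_zoom`) and tend, as `s ↑ 0`, to the apex values
`ℓ_j = μ_j⁻² ∫ ⟪v̂, φ(μ_j⁻¹(· - x₀))⟫` (`exists_apex_trace`, `integral_inner_zoom_eq`), whence
`|∫ ⟪u^{μ_j}(s), φ⟫ - ℓ_j| ≤ ω(|s|)` a.e.; `ℓ_j → 0` (`tendsto_apex_pairing_zero`), and the
pairings converge to `∫ ⟪w(s), φ⟫` for a.e. `s` along a subsequence (strong `L³` convergence),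
so `|∫ ⟪w(s), φ⟫| ≤ ω(|s|)` a.e. [cite: Seregin2014, §6.6 (6.6.3)] [cite: EscauriazaSereginSverak2003, §3 (3.13)] -/
theorem blowup_top_vanishing
    (h : IsL3inftyLocalPair 1 1 ((0 : ℝ), (0 : EuclideanSpace ℝ (Fin 3))) v p)
    {z₀ : ℝ × EuclideanSpace ℝ (Fin 3)}
    (hz₀ : z₀ ∈ closure (parabolicCylinder (1 / 2) ((0 : ℝ), (0 : EuclideanSpace ℝ (Fin 3)))))
    {δ : ℕ → ℕ} (hδge : ∀ k, k ≤ δ k)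
    {w : ℝ → EuclideanSpace ℝ (Fin 3) → EuclideanSpace ℝ (Fin 3)}
    (hwm : ∀ a : ℝ, 0 < a → MemLp (uncurry w) 3
      (volume.restrict (parabolicCylinder a (0 : ℝ × EuclideanSpace ℝ (Fin 3)))))
    (hconv : ∀ a : ℝ, 0 < a → Tendsto (fun j => eLpNorm
        (uncurry (((1 / 2 : ℝ) ^ (δ j + 2)) •
            stPull (((1 / 2 : ℝ) ^ (δ j + 2)) ^ 2) ((1 / 2 : ℝ) ^ (δ j + 2)) z₀.1 z₀.2 v) -
          uncurry w) 3
        (volume.restrict (parabolicCylinder a (0 : ℝ × EuclideanSpace ℝ (Fin 3)))))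
      atTop (𝓝 0))
    {φ : EuclideanSpace ℝ (Fin 3) → EuclideanSpace ℝ (Fin 3)} (hφ : ContDiff ℝ (⊤ : ℕ∞) φ)
    (hφc : HasCompactSupport φ) {ε : ℝ} (hε : 0 < ε) :
    ∃ s₀ : ℝ, s₀ < 0 ∧ ∀ᵐ s ∂(volume.restrict (Ioo s₀ 0)), |∫ y, ⟪w s y, φ y⟫| ≤ ε := by
  classical
  -- ## the radius `ρ ≥ 1` containing the support of `φ`, and the bounds of `φ`
  obtain ⟨R, hR⟩ := hφc.isCompact.isBounded.subset_closedBall (0 : EuclideanSpace ℝ (Fin 3))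
  set ρ : ℝ := max 1 (R + 1) with hρdef
  have hρ1 : 1 ≤ ρ := le_max_left _ _
  have hρ : 0 < ρ := one_pos.trans_le hρ1
  have hφρ : tsupport φ ⊆ ball (0 : EuclideanSpace ℝ (Fin 3)) ρ := fun x hx =>
    (closedBall_subset_ball (by rw [hρdef]; exact lt_of_lt_of_le (by linarith) (le_max_right _ _))) (hR hx)
  have hηt : FunctionSpaces.IsTestFunctionOn (⟨ball 0 ρ, isOpen_ball⟩ : Opens (EuclideanSpace ℝ (Fin 3))) φ :=
    ⟨hφ, hφc, hφρ⟩
  obtain ⟨K₀, K₁, K₂, hK₀, -, -⟩ := exists_bounds_of_isTestFunctionOn hηt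
  have hK₀0 : 0 ≤ K₀ := (norm_nonneg _).trans (hK₀ 0)
  -- ## the uniform modulus
  obtain ⟨A, B, hA, hB, hmod⟩ := exists_uniform_pairing_modulus_zoom h hz₀ hφ hφc hρ1 hφρ
  set ω : ℝ → ℝ := fun d => A * d + B * d ^ (1 / 3 : ℝ) with hω
  have hωmono : ∀ x y : ℝ, 0 ≤ x → x ≤ y → ω x ≤ ω y := by
    intro x y hx hxy
    simp only [hω]
    exact add_le_add (mul_le_mul_of_nonneg_left hxy hA)
      (mul_le_mul_of_nonneg_left (Real.rpow_le_rpow hx hxy (by norm_num)) hB)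
  -- ## the scales, from `j₀` on
  set lam : ℕ → ℝ := fun n => (1 / 2 : ℝ) ^ (n + 2) with hlam
  have hlam_pos : ∀ n, 0 < lam n := fun n => by positivity
  obtain ⟨j₀, hj₀⟩ := eventually_scale_mul_le_half hδge hρ
  set μ : ℕ → ℝ := fun j => lam (δ (j + j₀)) with hμdef
  have hμpos : ∀ j, 0 < μ j := fun j => hlam_pos _
  have hρμ : ∀ j, ρ * μ j ≤ 1 / 2 := fun j => hj₀ _ (Nat.le_add_left _ _)
  have hμ0 : Tendsto μ atTop (𝓝 0) := by
    have h1 : Tendsto (fun j : ℕ => (1 / 2 : ℝ) ^ (j + 2)) atTop (𝓝 0) :=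
      (tendsto_pow_atTop_nhds_zero_of_lt_one (by norm_num) (by norm_num)).comp (tendsto_add_atTop_nat 2)
    refine tendsto_of_tendsto_of_tendsto_of_le_of_le tendsto_const_nhds h1 (fun j => (hμpos j).le) fun j => ?_
    show (1 / 2 : ℝ) ^ (δ (j + j₀) + 2) ≤ (1 / 2) ^ (j + 2)
    exact pow_le_pow_of_le_one (by norm_num) (by norm_num) (by have := hδge (j + j₀); omega)
  set U : ℕ → ℝ → EuclideanSpace ℝ (Fin 3) → EuclideanSpace ℝ (Fin 3) :=
    fun j => (μ j) • stPull ((μ j) ^ 2) (μ j) z₀.1 z₀.2 v with hU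
  -- ## the transported test fields and the apex trace
  set θ : ℕ → EuclideanSpace ℝ (Fin 3) → EuclideanSpace ℝ (Fin 3) :=
    fun j x => φ ((μ j)⁻¹ • (x - z₀.2)) with hθ
  have hθt : ∀ j, FunctionSpaces.IsTestFunctionOn
      (⟨ball z₀.2 (1 / 2), isOpen_ball⟩ : Opens (EuclideanSpace ℝ (Fin 3))) (θ j) :=
    fun j => isTestFunctionOn_transport hφ hφc hφρ (hμpos j) (hρμ j) z₀.2
  obtain ⟨vh, hvh, htr⟩ := exists_apex_trace h hz₀ θ hθt
  set ℓ : ℕ → ℝ := fun j => (μ j ^ 2)⁻¹ * ∫ x, ⟪vh x, θ j x⟫ with hℓ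
  have hℓ0 : Tendsto ℓ atTop (𝓝 0) := tendsto_apex_pairing_zero hvh hK₀ hφρ hρ z₀.2 hμpos hμ0
  -- the pairings of the rescaled velocities
  set pair : ℕ → ℝ → ℝ := fun j s => ∫ y, ⟪U j s y, φ y⟫ with hpair
  have hpair_eq : ∀ j s, pair j s = (μ j ^ 2)⁻¹ * ∫ x in ball z₀.2 (1 / 2),
      ⟪v (z₀.1 + μ j ^ 2 * s) x, θ j x⟫ := by
    intro j s
    rw [hpair, hU]
    dsimp only
    rw [integral_inner_zoom_eq v φ (hμpos j) z₀ s,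
      integral_inner_eq_setIntegral_of_tsupport (hθt j).tsupport_subset]
    rfl
  -- ## KEY: `|pair_j(s) - ℓ_j| ≤ ω(|s|)` a.e. on `]-ρ², 0[`
  have hkey : ∀ j, ∀ᵐ s ∂(volume.restrict (Ioo (-ρ ^ 2) 0)), |pair j s - ℓ j| ≤ ω (|s|) := by
    intro j
    obtain ⟨S, hS, hSmod⟩ := hmod (μ j) (hμpos j) (hρμ j)
    filter_upwards [hS, ae_restrict_mem measurableSet_Ioo] with s hsS hsI
    refine le_of_forall_pos_le_add fun ε' hε' => ?_
    -- the apex trace for `θ_j`, at accuracy `μ² ε'`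
    obtain ⟨τ, hτ, hτtr⟩ := htr j (μ j ^ 2 * ε') (by have := hμpos j; positivity)
    -- transported to the `s`-variable: a.e. `σ ∈ ]-τ/μ², 0[`
    have htr' : ∀ᵐ σ ∂(volume.restrict (Ioo (-τ / μ j ^ 2) 0)), |pair j σ - ℓ j| ≤ ε' := by
      have hβ : 0 < μ j ^ 2 := pow_pos (hμpos j) 2
      have h0 : ∀ᵐ t ∂(volume.restrict (Ioo (z₀.1 + μ j ^ 2 * (-τ / μ j ^ 2)) (z₀.1 + μ j ^ 2 * 0))),
          |(∫ x in ball z₀.2 (1 / 2), ⟪v t x, θ j x⟫) - ∫ x, ⟪vh x, θ j x⟫| ≤ μ j ^ 2 * ε' := by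
        have e : Ioo (z₀.1 + μ j ^ 2 * (-τ / μ j ^ 2)) (z₀.1 + μ j ^ 2 * 0) = Ioo (z₀.1 - τ) z₀.1 := by
          rw [mul_div_cancel₀ _ hβ.ne', mul_zero, add_zero, ← sub_eq_add_neg]
        rw [e]; exact hτtr
      have h1 := ae_restrict_Ioo_comp_time_affine hβ z₀.1 (-τ / μ j ^ 2) 0 h0
      filter_upwards [h1] with σ hσ
      rw [hpair_eq, hℓ]
      dsimp only
      rw [← mul_sub, abs_mul, abs_of_pos (inv_pos.2 hβ)]
      rw [inv_mul_le_iff₀ hβ]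
      exact hσ
    -- a good `σ ∈ ]s, 0[`
    have hsneg : s < 0 := hsI.2
    set s₁ : ℝ := max s (-τ / μ j ^ 2) with hs₁
    have hs₁0 : s₁ < 0 := max_lt hsneg (by
      have := hμpos j; have : 0 < τ / μ j ^ 2 := by positivity
      rw [neg_div]; linarith)
    have hGσ : ∀ᵐ σ ∂(volume.restrict (Ioo s₁ 0)), σ ∈ S ∩ {σ | |pair j σ - ℓ j| ≤ ε'} := by
      have h1 : Ioo s₁ 0 ⊆ Ioo (-ρ ^ 2) 0 := Ioo_subset_Ioo ((hsI.1.le).trans (le_max_left _ _)) le_rfl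
      have h2 : Ioo s₁ 0 ⊆ Ioo (-τ / μ j ^ 2) 0 := Ioo_subset_Ioo (le_max_right _ _) le_rfl
      filter_upwards [ae_restrict_of_ae_restrict_of_subset h1 hS,
        ae_restrict_of_ae_restrict_of_subset h2 htr'] with σ h3 h4
      exact ⟨h3, h4⟩
    obtain ⟨σ, ⟨hσS, hσtr⟩, hσ1, -, hσ0⟩ := exists_mem_fullMeasure_near_top hs₁0 hGσ one_pos
    have hsσ : s < σ := (le_max_left _ _).trans_lt hσ1
    -- the estimate
    have h5 := hSmod s hsS σ hσS
    have hd : |s - σ| = σ - s := by rw [abs_sub_comm]; exact abs_of_pos (by linarith)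
    rw [hd] at h5
    have h6 : ω (σ - s) ≤ ω (|s|) := by
      refine hωmono _ _ (by linarith) ?_
      rw [abs_of_neg hsneg]; linarith
    calc |pair j s - ℓ j| ≤ |pair j s - pair j σ| + |pair j σ - ℓ j| := abs_sub_le _ _ _
      _ ≤ ω (σ - s) + ε' := add_le_add h5 hσtr
      _ ≤ ω (|s|) + ε' := add_le_add h6 le_rfl
  -- ## the pairings converge to the pairing of `w`, a.e. along a subsequence
  set I : Set ℝ := Ioo (-ρ ^ 2) 0 with hI
  set Bρ : Set (EuclideanSpace ℝ (Fin 3)) := ball 0 ρ with hBρ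
  have hQ : parabolicCylinder ρ (0 : ℝ × EuclideanSpace ℝ (Fin 3)) = I ×ˢ Bρ := by
    rw [parabolicCylinder, hI, hBρ]; simp
  set μQ : Measure (ℝ × EuclideanSpace ℝ (Fin 3)) := volume.restrict (I ×ˢ Bρ) with hμQ
  have hμQprod : μQ = (volume.restrict I).prod (volume.restrict Bρ) := by
    rw [hμQ, Measure.prod_restrict, ← Measure.volume_eq_prod]
  haveI : IsFiniteMeasure μQ := by
    refine ⟨?_⟩
    rw [hμQ, Measure.restrict_apply_univ, ← hQ]
    exact lt_of_le_of_lt (measure_mono (parabolicCylinder_subset_Icc_prod_closedBall _ _))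
      (isCompact_Icc_prod_closedBall _ _).measure_lt_top
  set pw : ℝ → ℝ := fun s => ∫ y, ⟪w s y, φ y⟫ with hpw
  have hwm' : MemLp (uncurry w) 3 μQ := by rw [hμQ, ← hQ]; exact hwm ρ hρ
  have hUm' : ∀ j, MemLp (uncurry (U j)) 3 μQ := by
    intro j
    refine ⟨?_, ?_⟩
    · rw [hμQ, ← hQ]
      exact aestronglyMeasurable_uncurry_zoom h hz₀ (hμpos j) hρ (hρμ j)
    · -- `∫_{Q(ρ)} |U_j|³ = ρ² C(ρ μ_j) < ∞`
      rw [eLpNorm_three_eq_lintegral_cube_rpow]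
      refine ENNReal.rpow_lt_top_of_nonneg (by norm_num) ?_
      rw [hμQ, ← hQ]
      have e : ∫⁻ z, ‖uncurry (U j) z‖ₑ ^ (3 : ℕ) ∂volume.restrict (parabolicCylinder ρ (0 : ℝ × EuclideanSpace ℝ (Fin 3))) =
          ∫⁻ z in parabolicCylinder ρ ((0 : ℝ), (0 : EuclideanSpace ℝ (Fin 3))),
            ‖((μ j) • stPull ((μ j) ^ 2) (μ j) z₀.1 z₀.2 v) z.1 z.2‖ₑ ^ (3 : ℕ) := rfl
      rw [e, lintegral_cube_zoom_radius (hμpos j) hρ z₀ v]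
      obtain ⟨M₁, hM₁⟩ := exists_cknC_le h
      exact ENNReal.mul_ne_top (ENNReal.pow_ne_top ENNReal.ofReal_ne_top)
        (ne_top_of_le_ne_top ENNReal.coe_ne_top (hM₁ z₀ hz₀ _ ⟨by positivity, hρμ j⟩))
  have hconv' : Tendsto (fun j => eLpNorm (uncurry (U j) - uncurry w) 3 μQ) atTop (𝓝 0) := by
    rw [hμQ, ← hQ]
    exact (tendsto_add_atTop_iff_nat (f := fun j => eLpNorm
      (uncurry ((lam (δ j)) • stPull ((lam (δ j)) ^ 2) (lam (δ j)) z₀.1 z₀.2 v) - uncurry w) 3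
        (volume.restrict (parabolicCylinder ρ (0 : ℝ × EuclideanSpace ℝ (Fin 3))))) j₀).2 (hconv ρ hρ)
  -- slice integrability, a.e. in `s`
  have hint_w : ∀ᵐ s ∂(volume.restrict I), Integrable (fun y => w s y) (volume.restrict Bρ) := by
    have h1 : Integrable (uncurry w) μQ := hwm'.integrable (by norm_num)
    rw [hμQprod] at h1
    filter_upwards [h1.prod_right_ae] with s hs
    exact hs
  have hint_U : ∀ j, ∀ᵐ s ∂(volume.restrict I), Integrable (fun y => U j s y) (volume.restrict Bρ) := by
    intro j
    have h1 : Integrable (uncurry (U j)) μQ := (hUm' j).integrable (by norm_num)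
    rw [hμQprod] at h1
    filter_upwards [h1.prod_right_ae] with s hs
    exact hs
  -- ## the `L¹(]-ρ²,0[)` distance of the pairings is controlled by `‖U_j - w‖_{L³(Q(ρ))}`
  have hφm : AEStronglyMeasurable φ (volume.restrict Bρ) := hφ.continuous.aestronglyMeasurable
  have hinner_int : ∀ {f : EuclideanSpace ℝ (Fin 3) → EuclideanSpace ℝ (Fin 3)},
      Integrable f (volume.restrict Bρ) → Integrable (fun y => ⟪f y, φ y⟫) (volume.restrict Bρ) := by
    intro f hf
    refine Integrable.mono' (hf.norm.mul_const K₀) (hf.1.inner hφm) (Eventually.of_forall fun y => ?_)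
    calc ‖⟪f y, φ y⟫‖ ≤ ‖f y‖ * ‖φ y‖ := norm_inner_le_norm _ _
      _ ≤ ‖f y‖ * K₀ := mul_le_mul_of_nonneg_left (hK₀ _) (norm_nonneg _)
  -- the difference of the pairings as one integral, a.e. in `s`
  have hdiff : ∀ j, ∀ᵐ s ∂(volume.restrict I),
      pair j s - pw s = ∫ y in Bρ, ⟪U j s y - w s y, φ y⟫ := by
    intro j
    filter_upwards [hint_w, hint_U j] with s hws hUs
    rw [hpair, hpw]
    dsimp only
    rw [integral_inner_eq_setIntegral_of_tsupport hφρ, integral_inner_eq_setIntegral_of_tsupport hφρ,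
      ← integral_sub (hinner_int hUs) (hinner_int hws)]
    refine integral_congr_ae (Eventually.of_forall fun y => ?_)
    show ⟪U j s y, φ y⟫ - ⟪w s y, φ y⟫ = ⟪U j s y - w s y, φ y⟫
    rw [inner_sub_left]
  -- integrability of the difference functions on the product and in `s`
  have hF_int : ∀ j, Integrable (fun z : ℝ × EuclideanSpace ℝ (Fin 3) => ⟪U j z.1 z.2 - w z.1 z.2, φ z.2⟫)
      ((volume.restrict I).prod (volume.restrict Bρ)) := by
    intro j
    have hD : Integrable (uncurry (U j) - uncurry w) ((volume.restrict I).prod (volume.restrict Bρ)) := by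
      rw [← hμQprod]; exact ((hUm' j).sub hwm').integrable (by norm_num)
    have hφm2 : AEStronglyMeasurable (fun z : ℝ × EuclideanSpace ℝ (Fin 3) => φ z.2)
        ((volume.restrict I).prod (volume.restrict Bρ)) :=
      (hφ.continuous.comp continuous_snd).aestronglyMeasurable
    refine Integrable.mono' (hD.norm.mul_const K₀) (hD.1.inner hφm2) (Eventually.of_forall fun z => ?_)
    calc ‖⟪U j z.1 z.2 - w z.1 z.2, φ z.2⟫‖ ≤ ‖U j z.1 z.2 - w z.1 z.2‖ * ‖φ z.2‖ := norm_inner_le_norm _ _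
      _ ≤ ‖(uncurry (U j) - uncurry w) z‖ * K₀ := mul_le_mul_of_nonneg_left (hK₀ _) (norm_nonneg _)
  have hdiff_int : ∀ j, Integrable (fun s => pair j s - pw s) (volume.restrict I) := by
    intro j
    have h1 := (hF_int j).integral_prod_left
    exact h1.congr ((hdiff j).mono fun s hs => hs.symm)
  have hpairL1 : ∀ j, eLpNorm (fun s => pair j s - pw s) 1 (volume.restrict I) ≤
      ENNReal.ofReal K₀ * (eLpNorm (uncurry (U j) - uncurry w) 3 μQ * μQ univ ^ (2 / 3 : ℝ)) := by
    intro j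
    -- pointwise in `s`
    have hpt : ∀ᵐ s ∂(volume.restrict I), ‖pair j s - pw s‖ₑ ≤
        ENNReal.ofReal K₀ * ∫⁻ y in Bρ, ‖U j s y - w s y‖ₑ := by
      filter_upwards [hdiff j] with s hs
      rw [hs]
      refine (enorm_integral_le_lintegral_enorm _).trans ?_
      rw [← lintegral_const_mul' _ _ ENNReal.ofReal_ne_top]
      refine lintegral_mono fun y => ?_
      rw [← ofReal_norm, ← ofReal_norm, ← ENNReal.ofReal_mul hK₀0]
      refine ENNReal.ofReal_le_ofReal ?_
      calc ‖⟪U j s y - w s y, φ y⟫‖ ≤ ‖U j s y - w s y‖ * ‖φ y‖ := norm_inner_le_norm _ _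
        _ ≤ ‖U j s y - w s y‖ * K₀ := mul_le_mul_of_nonneg_left (hK₀ _) (norm_nonneg _)
        _ = K₀ * ‖U j s y - w s y‖ := mul_comm _ _
    -- Tonelli
    have hDm : AEMeasurable (fun z : ℝ × EuclideanSpace ℝ (Fin 3) => ‖(uncurry (U j) - uncurry w) z‖ₑ)
        ((volume.restrict I).prod (volume.restrict Bρ)) := by
      rw [← hμQprod]; exact ((hUm' j).sub hwm').1.enorm
    have hT : ∫⁻ s in I, ∫⁻ y in Bρ, ‖U j s y - w s y‖ₑ = ∫⁻ z, ‖(uncurry (U j) - uncurry w) z‖ₑ ∂μQ := by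
      rw [hμQprod, lintegral_prod _ hDm]
      rfl
    rw [eLpNorm_one_eq_lintegral_enorm]
    calc ∫⁻ s, ‖pair j s - pw s‖ₑ ∂volume.restrict I
        ≤ ∫⁻ s in I, ENNReal.ofReal K₀ * ∫⁻ y in Bρ, ‖U j s y - w s y‖ₑ := lintegral_mono_ae hpt
      _ = ENNReal.ofReal K₀ * ∫⁻ z, ‖(uncurry (U j) - uncurry w) z‖ₑ ∂μQ := by
          rw [lintegral_const_mul' _ _ ENNReal.ofReal_ne_top, hT]
      _ = ENNReal.ofReal K₀ * eLpNorm (uncurry (U j) - uncurry w) 1 μQ := by rw [eLpNorm_one_eq_lintegral_enorm]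
      _ ≤ ENNReal.ofReal K₀ * (eLpNorm (uncurry (U j) - uncurry w) 3 μQ * μQ univ ^ (2 / 3 : ℝ)) := by
          refine mul_le_mul' le_rfl ?_
          have := eLpNorm_le_eLpNorm_mul_rpow_measure_univ (p := 1) (q := 3) (by norm_num)
            ((hUm' j).sub hwm').1
          rw [ENNReal.toReal_one, ENNReal.toReal_ofNat, show (1 / 1 - 1 / 3 : ℝ) = 2 / 3 by norm_num] at this
          exact this
  have hL1 : Tendsto (fun j => eLpNorm (fun s => pair j s - pw s) 1 (volume.restrict I)) atTop (𝓝 0) := by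
    have hfin : μQ univ ^ (2 / 3 : ℝ) ≠ ∞ := ENNReal.rpow_ne_top_of_nonneg (by norm_num) (measure_ne_top _ _)
    have h1 : Tendsto (fun j => ENNReal.ofReal K₀ * (eLpNorm (uncurry (U j) - uncurry w) 3 μQ * μQ univ ^ (2 / 3 : ℝ)))
        atTop (𝓝 0) := by
      have h2 := ENNReal.Tendsto.mul_const hconv' (Or.inr hfin)
      rw [zero_mul] at h2
      have h3 := ENNReal.Tendsto.const_mul (a := ENNReal.ofReal K₀) h2 (Or.inr ENNReal.ofReal_ne_top)
      rwa [mul_zero] at h3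
    exact tendsto_of_tendsto_of_tendsto_of_le_of_le tendsto_const_nhds h1 (fun j => bot_le) hpairL1
  -- a.e. convergence along a subsequence
  have hTIM : TendstoInMeasure (volume.restrict I) (fun j s => pair j s - pw s) atTop (fun _ => (0 : ℝ)) := by
    refine tendstoInMeasure_of_tendsto_eLpNorm one_ne_zero (fun j => (hdiff_int j).1) aestronglyMeasurable_const ?_
    refine (tendsto_congr fun j => ?_).1 hL1
    congr 1
    funext s
    simp
  obtain ⟨ns, hns, hae⟩ := hTIM.exists_seq_tendsto_ae
  -- ## `|pw(s)| ≤ ω(|s|)` a.e.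
  have hpw_le : ∀ᵐ s ∂(volume.restrict I), |pw s| ≤ ω (|s|) := by
    have hall : ∀ᵐ s ∂(volume.restrict I), ∀ j, |pair j s - ℓ j| ≤ ω (|s|) := ae_all_iff.2 hkey
    filter_upwards [hall, hae] with s hs1 hs2
    have h1 : Tendsto (fun k => pair (ns k) s - ℓ (ns k)) atTop (𝓝 (pw s - 0)) := by
      have h3 : Tendsto (fun k => pair (ns k) s - pw s) atTop (𝓝 0) := hs2
      have h4 : Tendsto (fun k => pair (ns k) s) atTop (𝓝 (pw s)) := by
        have := h3.add_const (pw s)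
        simpa using this
      exact h4.sub (hℓ0.comp hns.tendsto_atTop)
    rw [sub_zero] at h1
    exact le_of_tendsto' h1.abs fun k => hs1 (ns k)
  -- ## the choice of `s₀`
  obtain ⟨d, hd, hdω⟩ := exists_modulus_le hA hB hε
  set s₀ : ℝ := -min d (ρ ^ 2 / 2) with hs₀
  have hs₀neg : s₀ < 0 := by rw [hs₀, neg_lt_zero]; exact lt_min hd (by positivity)
  have hs₀I : Ioo s₀ 0 ⊆ I := by
    refine Ioo_subset_Ioo ?_ le_rfl
    rw [hs₀, neg_le_neg_iff]
    have := min_le_right d (ρ ^ 2 / 2)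
    nlinarith
  refine ⟨s₀, hs₀neg, ?_⟩
  filter_upwards [ae_restrict_of_ae_restrict_of_subset hs₀I hpw_le, ae_restrict_mem measurableSet_Ioo] with s hs hsI'
  refine hs.trans (hdω _ (abs_nonneg s) ?_)
  rw [abs_of_neg hsI'.2]
  have := min_le_left d (ρ ^ 2 / 2)
  linarith [hsI'.1]

end Top

end Literature.Analysis.FluidPDE
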